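import Summits.ABC.IUTFork.Cor312ProvenanceMod
import Literature.NumberTheory.DiophantineGeometry.GenEllMellReduction
import HarnessLib

/-!
# [IUTchIII] Cor. 3.12 provenance — the (P5) choice of `𝕍^bad_mod` as PRINTED (over `F_mod`, through `j`) implies its
# `F`-level reading used by the point dictionary (c312 crew, wave 2, board row W2-F′)

Record-only companion (seat abc-iut-c312-8, gen 2); TAKES NO SIDE on Cor. 3.12. The point dictionary
(`Cor312ProvenancePoint`, `…PointJ`) reads the (P5) choice of [IUTchIV] Cor. 2.2 (ii), proof, kurims p. 46 —
"(P5) `𝕍^bad_mod :=` the nonarchimedean valuations [of `F_mod`] that do not divide `2l` and at which `E_F` has bad multiplicative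
reduction" — at the level of `F`, as the hypothesis
`hV : v ∈ 𝕍(F)^bad ↔ (v ∤ 2 ∧ v ∤ l) ∧ E_F has multiplicative reduction at v`.
The (P7) constructor of the initial Θ-data (definition request defn-IsThetaAdmissible; abc-iut-L5-t7's planned
`InitialThetaData.ofLegendre`, plan ruling 23:31:36Z: `E_F := E_{F_mod} ⊗ F`) will define `𝕍^bad_mod` over `F_mod = ℚ(j)`; since
`E_F` is semistable ([IUTchI] Def. 3.1 (b)) and `j(E_F) ∈ F_mod`, "multiplicative reduction at `v`" is "`|j|_v > 1`", i.e.
"`ord_w(j) < 0`" at the place `w = v ∩ F_mod` — a condition on `w` alone. THIS FILE proves that the `F_mod`-level (P5) set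
`{w : w ∤ 2l, ord_w(j) < 0}` pulls back to the `F`-level reading (all PROVED):

* `natCast_mem_maximalIdeal_finBelow_iff` — `w ∣ p ⟺ v ∣ p` for the place `w` of `F_mod` under `v` and a rational prime `p`;
* `ord_j_neg_of_hasMultiplicativeReductionAt`, `hasMultiplicativeReductionAt_of_ord_j_neg(_of_isSemistable)`,
  `hasMultiplicativeReductionAt_iff_ord_j_neg_of_isSemistable` — for a semistable `E_F` (in particular that of an initial
  Θ-datum; the `_of_isSemistable` forms serve the (P7) constructor BEFORE the datum exists): multiplicative at `v` ⟺ `ord_v(j(E_F)) < 0` (Tate / Silverman AEC VII.5.1: the tree's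
  `log_valuation_j_eq_ordMinimalDiscriminant_of_hasMultiplicativeReductionAt` and `valuation_j_le_one_of_hasGoodReduction_localMinimalModel`);
* `ord_j_neg_iff_ord_mod_neg` — `ord_v(j) < 0 ⟺ ord_w(j) < 0` (`ord_v = e_{v|w}·ord_w`, `ord_algebraMap`);
* **`vFbad_iff_of_vbadMod_P5`** — IF `𝕍^bad_mod = {w : (w ∤ 2 ∧ w ∤ l) ∧ ord_w(j) < 0}` (the printed (P5), `F_mod`-level, through
  `j`), THEN `hV` holds: `v ∈ 𝕍(F)^bad ↔ (v ∤ 2 ∧ v ∤ l) ∧ E_F multiplicative at v`; so the hypothesis of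
  `display_of_j_extend` / `logq_eq_logQAvoid_of_j` is exactly the printed (P5).
`j` is carried as `jm ∈ F_mod` with `jm = j(E_F)` in `F` (no definition). [claim: Mochizuki2012, status: disputed] for every quotation.
-/

noncomputable section

namespace Summit.ABC.IUTFork.Cor312Prov

open Literature.IUT.HodgeTheaters Literature.IUT.LogVolume NumberField IsDedekindDomain
open Literature.NumberTheory.DiophantineGeometry.GenEll
open scoped Classical

variable {F K Fbar : Type} [Field F] [NumberField F] [Field K] [NumberField K]
  [Algebra F K] [Field Fbar] [Algebra F Fbar] [Algebra K Fbar] {E : WeierstrassCurve F} [E.IsElliptic]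
  {l : ℕ} {Pb : BadPlacePredicates K}

/-- For a natural number `p` (a rational prime in the applications) and a finite place `v` of `F` over the place `w = v ∩ F_mod`
of `F_mod`: `p ∈ w ⟺ p ∈ v`. PROVED. [claim: Mochizuki2012, status: disputed] -/
theorem natCast_mem_maximalIdeal_finBelow_iff (v : FinitePlace F) (p : ℕ) :
    ((p : ℕ) : 𝓞 (fieldOfModuli E)) ∈ (Thm311.Real.finBelow (E := E) v).maximalIdeal.asIdeal ↔
      ((p : ℕ) : 𝓞 F) ∈ v.maximalIdeal.asIdeal := by
  rw [maximalIdeal_finBelow (E := E)]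
  change ((p : ℕ) : 𝓞 (fieldOfModuli E)) ∈ Ideal.comap (algebraMap (𝓞 (fieldOfModuli E)) (𝓞 F)) v.maximalIdeal.asIdeal ↔ _
  rw [Ideal.mem_comap, map_natCast]

/-- **Multiplicative reduction ⟹ `ord_v(j) < 0`** (`−ord_v(j) = ord_v(Δ_min) ≥ 1`, Silverman AEC VII.5.1 (b); the tree's
`log_valuation_j_eq_ordMinimalDiscriminant_of_hasMultiplicativeReductionAt`, `ordMinimalDiscriminant_ne_zero_of_hasMultiplicativeReductionAt`).
PROVED. [claim: Mochizuki2012, status: disputed] -/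
theorem ord_j_neg_of_hasMultiplicativeReductionAt {v : HeightOneSpectrum (𝓞 F)} (hv : E.HasMultiplicativeReductionAt v) :
    ord F v E.j < 0 := by
  have hne := WeierstrassCurve.ordMinimalDiscriminant_ne_zero_of_hasMultiplicativeReductionAt v E hv
  unfold ord
  rw [E.log_valuation_j_eq_ordMinimalDiscriminant_of_hasMultiplicativeReductionAt v hv]
  omega

/-- **`ord_v(j) < 0` ⟹ multiplicative reduction, for a SEMISTABLE curve** (the form the (P7) constructor needs BEFORE the datum
exists: semistability of `E_F` comes from the rationality of the `2·3·5`-torsion, [IUTchIV] Prop. 1.8 (v), abc-iut-S5): otherwise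
`E_F` has good reduction at `v`, whence `|j|_v ≤ 1` (Silverman AEC VII.5.1 (a); the tree's
`valuation_j_le_one_of_hasGoodReduction_localMinimalModel`), i.e. `ord_v(j) ≥ 0`. PROVED. [claim: Mochizuki2012, status: disputed] -/
theorem hasMultiplicativeReductionAt_of_ord_j_neg_of_isSemistable (hss : E.IsSemistable (𝓞 F))
    {v : HeightOneSpectrum (𝓞 F)} (hv : ord F v E.j < 0) : E.HasMultiplicativeReductionAt v := by
  by_contra hnm
  have hgood : E.HasGoodReductionAt v := (hss v).resolve_right hnm
  have hle : v.valuation F E.j ≤ 1 := valuation_j_le_one_of_hasGoodReduction_localMinimalModel v E hgood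
  have hge : 0 ≤ ord F v E.j := by
    unfold ord
    by_cases hj0 : v.valuation F E.j = 0
    · rw [hj0, WithZero.log_zero, neg_zero]
    · rw [neg_nonneg, WithZero.log_le_iff_le_exp hj0, WithZero.exp_zero]
      exact hle
  omega

/-- For a semistable curve: multiplicative at `v` ⟺ `ord_v(j) < 0` (the two lemmas above). PROVED.
[claim: Mochizuki2012, status: disputed] -/
theorem hasMultiplicativeReductionAt_iff_ord_j_neg_of_isSemistable (hss : E.IsSemistable (𝓞 F))
    (v : HeightOneSpectrum (𝓞 F)) : E.HasMultiplicativeReductionAt v ↔ ord F v E.j < 0 :=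
  ⟨ord_j_neg_of_hasMultiplicativeReductionAt, hasMultiplicativeReductionAt_of_ord_j_neg_of_isSemistable hss⟩

/-- **`ord_v(j) < 0` ⟹ multiplicative reduction, for the (semistable) curve of an initial Θ-datum** ([IUTchI] Def. 3.1 (b): stable
reduction at every finite place, L5-t2's `isSemistable`). PROVED. [claim: Mochizuki2012, status: disputed] -/
theorem hasMultiplicativeReductionAt_of_ord_j_neg (D : InitialThetaData F K Fbar E l Pb) {v : HeightOneSpectrum (𝓞 F)}
    (hv : ord F v E.j < 0) : E.HasMultiplicativeReductionAt v :=
  hasMultiplicativeReductionAt_of_ord_j_neg_of_isSemistable D.isSemistable hv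

/-- `ord_v(j) < 0 ⟺ ord_w(j) < 0` for the place `w = v ∩ F_mod` under `v` (`ord_v(j) = e_{v|w}·ord_w(j)`, `e_{v|w} ≥ 1`; `jm ∈ F_mod`
any element equal to `j(E_F)` in `F`). PROVED. [claim: Mochizuki2012, status: disputed] -/
theorem ord_j_neg_iff_ord_mod_neg (jm : fieldOfModuli E) (hjm : (jm : F) = E.j) (v : FinitePlace F) :
    ord F v.maximalIdeal E.j < 0 ↔
      ord (fieldOfModuli E) (Thm311.Real.finBelow (E := E) v).maximalIdeal jm < 0 := by
  rw [maximalIdeal_finBelow (E := E), ← hjm]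
  change ord F v.maximalIdeal (algebraMap (fieldOfModuli E) F jm) < 0 ↔ _
  rw [ord_algebraMap]
  have he : (0 : ℤ) < Ideal.ramificationIdx'
      (Literature.IUT.LogVolume.finBelow (fieldOfModuli E) F v.maximalIdeal).asIdeal v.maximalIdeal.asIdeal := by
    exact_mod_cast Nat.pos_of_ne_zero (Ideal.IsDedekindDomain.ramificationIdx'_ne_zero_of_liesOver
      v.maximalIdeal.asIdeal (Literature.IUT.LogVolume.finBelow (fieldOfModuli E) F v.maximalIdeal).ne_bot)
  constructor
  · intro h
    by_contra hge
    exact absurd h (not_lt.mpr (mul_nonneg he.le (not_lt.mp hge)))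
  · intro h
    exact mul_neg_of_pos_of_neg he h

/-- **The printed (P5) (over `F_mod`, through `j`) implies its `F`-level reading.** If the initial Θ-datum's `𝕍^bad_mod` is
"the nonarchimedean valuations of `F_mod` that do not divide `2l` and at which `E_F` has bad multiplicative reduction" in the form
`w ∈ 𝕍^bad_mod ↔ (w ∤ 2 ∧ w ∤ l) ∧ ord_w(j) < 0` (`hmod`; [IUTchIV] p. 46 (P5), with "multiplicative at the places over `w`" ⟺
"`|j|_w > 1`" for the semistable `E_F`, `j(E_F) ∈ F_mod`), then for every finite place `v` of `F`:
`v ∈ 𝕍(F)^bad ↔ (v ∤ 2 ∧ v ∤ l) ∧ E_F has multiplicative reduction at v` — the hypothesis `hV` of `display_of_j_extend`,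
`logq_eq_logQAvoid_of_j`, `display_thetaCurve`. PROVED. [claim: Mochizuki2012, status: disputed] -/
theorem vFbad_iff_of_vbadMod_P5 (D : InitialThetaData F K Fbar E l Pb) (jm : fieldOfModuli E) (hjm : (jm : F) = E.j)
    (hmod : ∀ w : FinitePlace (fieldOfModuli E), w ∈ D.VbadMod ↔
      (∀ p ∈ ({2, l} : Finset ℕ), ((p : ℕ) : 𝓞 (fieldOfModuli E)) ∉ w.maximalIdeal.asIdeal) ∧
        ord (fieldOfModuli E) w.maximalIdeal jm < 0)
    (v : FinitePlace F) :
    v ∈ D.VFbad ↔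
      (∀ p ∈ ({2, l} : Finset ℕ), ((p : ℕ) : 𝓞 F) ∉ v.maximalIdeal.asIdeal) ∧
        E.HasMultiplicativeReductionAt v.maximalIdeal := by
  rw [mem_VFbad_iff_finBelow_mem, hmod, ← ord_j_neg_iff_ord_mod_neg jm hjm v]
  have hp : (∀ p ∈ ({2, l} : Finset ℕ), ((p : ℕ) : 𝓞 (fieldOfModuli E)) ∉
      (Thm311.Real.finBelow (E := E) v).maximalIdeal.asIdeal) ↔
      ∀ p ∈ ({2, l} : Finset ℕ), ((p : ℕ) : 𝓞 F) ∉ v.maximalIdeal.asIdeal := by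
    refine forall₂_congr fun p _ => ?_
    rw [natCast_mem_maximalIdeal_finBelow_iff]
  rw [hp]
  exact and_congr_right fun _ =>
    ⟨hasMultiplicativeReductionAt_of_ord_j_neg D, ord_j_neg_of_hasMultiplicativeReductionAt⟩

end Summit.ABC.IUTFork.Cor312Prov

end
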